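import Literature.NumberTheory.Automorphic.UnitaryDualPairDoubledDiagonalThetaInvariance
import Literature.NumberTheory.GelbartRogawski1991.UnitaryDualPairSplittingDatumCongruence
import Literature.NumberTheory.QuadraticForms.HasseMinkowskiDiagonal
import HarnessLib

/-!
# H413 · E-2 · SW2 (iii) · A6 INPUT ADAPTER — (a) the EQUATION BINDERS of `hdom_CM` ∕ `hIMPL_CM`

Cell `hodgecm-mathlib`, crux H413 (`stmt-HodgeConjecture-24833`), child line `Cruxes/H413/Lines/F0_E2SiegelWeilWeilRange.lean`,
`StubSW2` (iii), binder `hBOUND` of ★ `E2SWDilateBoundCM.hbd_CM` through A6 `exists_borelBound_CM` (F0P4-p07 (g3)) and its `hdom`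
input `E2SWBorelBoundLettersCM.hdom_CM` (F0P4-p05 (g3), census P4 bus 05:29:09Z).  PROOF lane, `--supports stmt-HodgeConjecture-24833`
(helper; closes nothing by itself).  HC_CM is proved only modulo the 7 printed citations until rung 0 closes.

The adapter runs the DIAGONAL-only domination letters (★ `Weil1964/ArchDualPairThetaMajorantsInrConj` §1 `…_inr_of_signs`, §1b
`…_inr_of_isTotallyComplex_two`) at diagonal data `(diagonal c, diagonal ![t, −t])` and transports them to the data of record
`(TV, reindex fSFE fSFE (fromBlocks TW 0 0 (−TW)))` along the Gelbart–Rogawski congruence transport (★ `UnitaryDualPair.congrMp ∕ congrSp ∕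
congrPair ∕ toSp_congr ∕ proj_congrMp`, stated for CONGRUENT data `(P_Vᵀ T_V P_V, P_Wᵀ T_W P_W)`).  The three identities that make the
data of record LITERALLY congruent data — the «EQUATION binders `subst`-ed inside» of the census — are proved here once:

* (a1) `exists_congr_diagonal_inv` — every non-degenerate symmetric `TV` IS congruent data over a diagonal matrix with non-zero entries:
  `∃ Q c, IsUnit Q.det ∧ (∀ i, c i ≠ 0) ∧ Qᵀ * diagonal c * Q = TV` (★ `QuadraticForms.exists_congr_diagonal` — Serre IV §1.4 — inverted),
  with the two-sided inverse `P` recorded in `exists_congr_diagonal_inv'`;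
* (a2) `one_transpose_mul_diagonal_mul_one_eq_doubled` — `1ᵀ * diagonal ![TW 0 0, −TW 0 0] * 1 = reindex fSFE fSFE (fromBlocks TW 0 0 (−TW))`
  (and the bare `diagonal_pair_eq_doubled`), plus the non-degeneracy ∕ symmetry riders of the diagonal `W`-datum;
* (a3) `adelicGram_doubledPair_eq` — `adelicGram F e□ TV (reindex fSFE fSFE (fromBlocks TW 0 0 (−TW))) = doubledGramFin F (adelicGram F e TV TW)`
  (★ `UnitaryGroup.adelicGram_doubled_eq_doubledGramFin` with its `hTW2` discharged by `rfl`, so the consumer's `subst`∕`rw` has no side goal).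

[cite: Serre1973, Ch. IV §1.4] [cite: GelbartRogawski1991, §3.1 p. 454 L41–42] [cite: GelbartPiatetskishapiroRallis1987, Part A §2 pp. 7–9]
-/

set_option autoImplicit false
-- the cell's `Summit.HodgeConjecture.HodgeConjecture.…` namespace repeats the summit name by design (D-0017 layout)
set_option linter.dupNamespace false

namespace Summit.HodgeConjecture.HodgeConjecture.Cruxes.H413.E2SWBorelBoundLettersCM

open scoped Matrix
open NumberField
open Literature.NumberTheory.Automorphic Literature.NumberTheory.Automorphic.UnitaryGroup
open Literature.NumberTheory.GelbartRogawski1991 Literature.NumberTheory.GelbartRogawski1991.UnitaryDualPair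
open Literature.NumberTheory.Weil1964

/-! ## (a1) every non-degenerate symmetric matrix is congruent data over a non-degenerate diagonal one -/

/-- **(a1′) `TV = Qᵀ · diagonal c · Q`** with `P Q = Q P = 1`, `Pᵀ TV P = diagonal c` and all `cᵢ ≠ 0`, for every symmetric `TV` with
`det TV` a unit over a field of characteristic `≠ 2`: ★ `QuadraticForms.exists_congr_diagonal` read backwards
(`Qᵀ (Pᵀ TV P) Q = (PQ)ᵀ TV (PQ) = TV`), both `P` and `Q` recorded. [cite: Serre1973, Ch. IV §1.4] -/
theorem exists_congr_diagonal_inv' {K : Type*} [Field K] [NeZero (2 : K)] {N : ℕ}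
    (TV : Matrix (Fin N) (Fin N) K) (hV : TV.IsSymm) (hVd : IsUnit TV.det) :
    ∃ (P Q : Matrix (Fin N) (Fin N) K) (c : Fin N → K), P * Q = 1 ∧ Q * P = 1 ∧ (∀ i, c i ≠ 0) ∧
      Pᵀ * TV * P = Matrix.diagonal c ∧ Qᵀ * Matrix.diagonal c * Q = TV := by
  obtain ⟨P, Q, c, hPQ, hQP, hP, hc⟩ := Literature.NumberTheory.QuadraticForms.exists_congr_diagonal TV hV
  refine ⟨P, Q, c, hPQ, hQP, hc hVd.ne_zero, hP, ?_⟩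
  rw [← hP]
  calc Qᵀ * (Pᵀ * TV * P) * Q = (P * Q)ᵀ * TV * (P * Q) := by
        rw [Matrix.transpose_mul]; simp only [Matrix.mul_assoc]
    _ = TV := by rw [hPQ, Matrix.transpose_one, Matrix.one_mul, Matrix.mul_one]

/-- **(a1) `TV = Qᵀ · diagonal c · Q` with `IsUnit Q.det` and all `cᵢ ≠ 0`** — the `(P_V, T_V)` slot of the Gelbart–Rogawski congruence
transport (`hPV : IsUnit P_V.det`, congruent data `P_Vᵀ T_V P_V`) for ANY non-degenerate symmetric `TV`. [cite: Serre1973, Ch. IV §1.4] -/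
theorem exists_congr_diagonal_inv {K : Type*} [Field K] [NeZero (2 : K)] {N : ℕ}
    (TV : Matrix (Fin N) (Fin N) K) (hV : TV.IsSymm) (hVd : IsUnit TV.det) :
    ∃ (Q : Matrix (Fin N) (Fin N) K) (c : Fin N → K), IsUnit Q.det ∧ (∀ i, c i ≠ 0) ∧ Qᵀ * Matrix.diagonal c * Q = TV := by
  obtain ⟨P, Q, c, hPQ, -, hc, -, hQ⟩ := exists_congr_diagonal_inv' TV hV hVd
  exact ⟨Q, c, Matrix.isUnit_det_of_left_inverse hPQ, hc, hQ⟩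

/-- the diagonal datum of (a1) is itself symmetric and non-degenerate (riders for the transport's `hV hVd` at the diagonal data).
[cite: Serre1973, Ch. IV §1.4] -/
theorem isSymm_and_isUnit_det_diagonal {K : Type*} [Field K] {N : ℕ} {c : Fin N → K} (hc : ∀ i, c i ≠ 0) :
    (Matrix.diagonal c).IsSymm ∧ IsUnit (Matrix.diagonal c).det :=
  ⟨Matrix.isSymm_diagonal c, by rw [Matrix.det_diagonal]; exact isUnit_iff_ne_zero.2 (Finset.prod_ne_zero_iff.2 fun i _ => hc i)⟩

/-! ## (a2) the doubled rank-one `W`-datum `T_W ⊕ (−T_W)` is the diagonal matrix `diag(t, −t)`, `t = T_W 0 0` -/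

/-- **(a2) `diagonal ![TW 0 0, −TW 0 0] = reindex fSFE fSFE (fromBlocks TW 0 0 (−TW))`** for a `1 × 1` matrix `TW` (entrywise, four cases).
[cite: GelbartRogawski1991, §3.1 p. 454 L41–42] -/
theorem diagonal_pair_eq_doubled {K : Type*} [Ring K] (TW : Matrix (Fin 1) (Fin 1) K) :
    (Matrix.diagonal ![TW 0 0, -TW 0 0] : Matrix (Fin (1 + 1)) (Fin (1 + 1)) K) =
      Matrix.reindex finSumFinEquiv finSumFinEquiv (Matrix.fromBlocks TW 0 0 (-TW)) := by
  ext i j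
  fin_cases i <;> fin_cases j <;> rfl

/-- **(a2) as CONGRUENT DATA: `1ᵀ * diagonal ![TW 0 0, −TW 0 0] * 1 = reindex fSFE fSFE (fromBlocks TW 0 0 (−TW))`** — the `(P_W, T_W)` slot
of the Gelbart–Rogawski congruence transport with `P_W := 1`. [cite: GelbartRogawski1991, §3.1 p. 454 L41–42] -/
theorem one_transpose_mul_diagonal_mul_one_eq_doubled {K : Type*} [Ring K] (TW : Matrix (Fin 1) (Fin 1) K) :
    (1 : Matrix (Fin (1 + 1)) (Fin (1 + 1)) K)ᵀ * Matrix.diagonal ![TW 0 0, -TW 0 0] * 1 =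
      Matrix.reindex finSumFinEquiv finSumFinEquiv (Matrix.fromBlocks TW 0 0 (-TW)) := by
  rw [Matrix.transpose_one, Matrix.one_mul, Matrix.mul_one]
  exact diagonal_pair_eq_doubled TW

/-- the entries `t, −t` of the diagonal `W`-datum are non-zero when `det TW` is a unit (`det TW = TW 0 0` for a `1 × 1` matrix).
[cite: GelbartRogawski1991, §3.1 p. 454 L41–42] -/
theorem pair_ne_zero {K : Type*} [Field K] (TW : Matrix (Fin 1) (Fin 1) K) (hWd : IsUnit TW.det) : ∀ i, ![TW 0 0, -TW 0 0] i ≠ 0 := by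
  have ht : TW 0 0 ≠ 0 := by rw [← Matrix.det_fin_one TW]; exact hWd.ne_zero
  intro i
  fin_cases i
  · exact ht
  · exact neg_ne_zero.2 ht

/-- the diagonal `W`-datum is symmetric with unit determinant, and `P_W = 1` has unit determinant (riders for the transport's
`hW hWd hPW`). [cite: GelbartRogawski1991, §3.1 p. 454 L41–42] -/
theorem diagonal_pair_riders {K : Type*} [Field K] (TW : Matrix (Fin 1) (Fin 1) K) (hWd : IsUnit TW.det) :
    (Matrix.diagonal ![TW 0 0, -TW 0 0]).IsSymm ∧ IsUnit (Matrix.diagonal ![TW 0 0, -TW 0 0]).det ∧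
      IsUnit (1 : Matrix (Fin (1 + 1)) (Fin (1 + 1)) K).det :=
  ⟨(isSymm_and_isUnit_det_diagonal (pair_ne_zero TW hWd)).1, (isSymm_and_isUnit_det_diagonal (pair_ne_zero TW hWd)).2,
    by rw [Matrix.det_one]; exact isUnit_one⟩

/-! ## (a3) the adelic Gram matrix of the doubled pair is `doubledGramFin` of the Gram matrix of the pair -/

/-- **(a3) `adelicGram F e□ TV (reindex fSFE fSFE (fromBlocks TW 0 0 (−TW))) = doubledGramFin F (adelicGram F e TV TW)`** with the doubled
relabelling `e□ := ((prodCongr (refl (Fin N)) fSFE⁻¹) ∘ prodSumDistrib) ∘ (sumCongr e e ∘ fSFE)` of the A4 letters — ★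
`UnitaryGroup.adelicGram_doubled_eq_doubledGramFin` with its hypothesis `hTW2 : TW2 = finSum 1 1 TW (−TW)` discharged by `rfl` at the
spelling of record, so that the consumer rewrites with NO side goal. [cite: GelbartPiatetskishapiroRallis1987, Part A §2 pp. 7–9] -/
theorem adelicGram_doubledPair_eq (F : Type) [Field F] [NumberField F] (N : ℕ) {n : ℕ} (e : Fin N × Fin 1 ≃ Fin n)
    (TV : Matrix (Fin N) (Fin N) F) (TW : Matrix (Fin 1) (Fin 1) F) :
    adelicGram F
        (((Equiv.prodCongr (Equiv.refl (Fin N)) finSumFinEquiv.symm).trans (Equiv.prodSumDistrib (Fin N) (Fin 1) (Fin 1))).trans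
          ((Equiv.sumCongr e e).trans finSumFinEquiv))
        TV (Matrix.reindex finSumFinEquiv finSumFinEquiv (Matrix.fromBlocks TW 0 0 (-TW))) =
      doubledGramFin F (adelicGram F e TV TW) :=
  adelicGram_doubled_eq_doubledGramFin (F := F) (N := N) (e := e) (TV := TV) (TW := TW) rfl

/-- (a3) at the CONGRUENT spelling of the `W`-datum (after (a2)): `adelicGram F e□ TV (1ᵀ * diagonal ![TW 0 0, −TW 0 0] * 1) = doubledGramFin …`.
[cite: GelbartPiatetskishapiroRallis1987, Part A §2 pp. 7–9] -/
theorem adelicGram_doubledPair_eq_of_diagonal (F : Type) [Field F] [NumberField F] (N : ℕ) {n : ℕ} (e : Fin N × Fin 1 ≃ Fin n)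
    (TV : Matrix (Fin N) (Fin N) F) (TW : Matrix (Fin 1) (Fin 1) F) :
    adelicGram F
        (((Equiv.prodCongr (Equiv.refl (Fin N)) finSumFinEquiv.symm).trans (Equiv.prodSumDistrib (Fin N) (Fin 1) (Fin 1))).trans
          ((Equiv.sumCongr e e).trans finSumFinEquiv))
        TV ((1 : Matrix (Fin (1 + 1)) (Fin (1 + 1)) F)ᵀ * Matrix.diagonal ![TW 0 0, -TW 0 0] * 1) =
      doubledGramFin F (adelicGram F e TV TW) := by
  rw [one_transpose_mul_diagonal_mul_one_eq_doubled]
  exact adelicGram_doubledPair_eq F N e TV TW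

end Summit.HodgeConjecture.HodgeConjecture.Cruxes.H413.E2SWBorelBoundLettersCM
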